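import Literature.NumberTheory.Automorphic.UnitaryGroupCohomologicalFormsConjPullback
import HarnessLib

/-!
# `g ↦ ḡ = (c ⊗ 1) g` from `U(J)(𝔸_F)` onto `U(c J)(𝔸_F)` for an ARBITRARY hermitian matrix `J` over `E`, and its
# compatibility with the finite-adelic and archimedean factors, the rational points, the archimedean sections and the compact factor

Topic `NumberTheory/Automorphic`; namespace `Literature.NumberTheory.Automorphic.UnitaryGroup`.  KERNEL: definitions by explicit formula
(`adelicConjTo`, `finAdelicConjTo`, `rationalConjTo`, `archConjTo` — all `GL(c ⊗ 1)` restricted) + theorems; no named fact, no instance, no notation,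
no `sorry`.  This is the two-form version (source `U(J)`, target `U(cJ)`) of the tree's entrywise conjugations for `F`-RATIONAL `J`
(`GelbartRogawski1991/DoubledUnitaryConj.adelicUnitaryConj`, cell COR-CM's `finAdelicConj`∕`finConjV`): for a general hermitian `J` (`(cJ)ᵀ = J`) the
conjugate `c J = Jᵀ` is another hermitian matrix and `g ↦ ḡ` identifies `U(J)` with `U(cJ)` over every `F`-algebra.  Cell hodgecm-mathlib
(D-0151), floor 0, programme P2: the group-side half of the CONJ-TWIST for the letter Θ-OCC-GEN of crux H413 (the representation side is COR-CM's
RSCONJ θ-twist; the archimedean side is `UnitaryGroupCohomologicalFormsConjPullback`).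

* §1 `adelicConjTo : U(J)(𝔸_F) →* U(cJ)(𝔸_F)`, `finAdelicConjTo`, `rationalConjTo`, `archConjTo` and their underlying-matrix formulas; surjectivity of
  `adelicConjTo` when `c` is an involution (`adelicConjTo_surjective`).
* §2 compatibilities: `adelicConjTo (1, g) = (1, \\overline{g})` (`adelicConjTo_finAdelicToAdelic`), `adelicConjTo (γ) = \\overline{γ}` on rational points
  (`adelicConjTo_toAdelic`), `adelicConjTo (g_∞, 1) = (\\overline{g_∞}, 1)` (`adelicConjTo_archToAdelic`), and place by place
  `(\\overline{g_∞})_w = \\overline{(g_∞)_w}` (`coe_archAt_archConjTo`).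
* §3 CM frames (`F = L⁺`, `c` = complex conjugation, `N = 3`, a frame `T` of `H` at `ι`): `T̄` is a frame of `c̄H` at the SAME `ι`
  (`conjTranspose_conjFrame_map_conj_mul`), **`adelicConjTo (cmArchSection L ι H T u) = cmArchSection L ι (c̄H) T̄ ū`** (`adelicConjTo_cmArchSection`; the un-twist
  `embTwist ι` is the same on both sides and commutes with conjugation), and `adelicConjTo` carries `cmCompactFactor L ι H T` into `cmCompactFactor L ι (c̄H) T̄`
  (`adelicConjTo_mem_cmCompactFactor`).

References: [PlatonovRapinchuk1994] V. Platonov, A. Rapinchuk, *Algebraic Groups and Number Theory* (1994), §2.3 (unitary groups of hermitian forms;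
`U(h) ≅ U(h^σ)` along a field automorphism), §5.1 (adele groups, `G_𝔸 = G_∞ × G_{𝔸_f}`); [BorelJacquet1979] A. Borel, H. Jacquet, PSPM 33.1 (1979), §4.1.
Nothing of print is asserted; HC_CM is proved only modulo the printed citations until rung 0 closes.
-/

noncomputable section

open NumberField NumberField.InfinitePlace NumberField.mixedEmbedding IsDedekindDomain MulAction
open scoped Matrix ComplexConjugate

namespace Literature.NumberTheory.Automorphic.UnitaryGroup

open Literature.Geometry.ComplexHyperbolic Literature.Geometry.ComplexHyperbolic.BallModel
open Literature.AlgebraicGeometry.ShimuraVarieties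

/-! ## §1 The conjugations `U(J) → U(cJ)` over `𝔸_F`, `𝔸_{F,f}`, `F`, `F ⊗ ℝ` -/

section Generic

variable (F E : Type) [Field F] [NumberField F] [Field E] [NumberField E] [Algebra F E] (c : E ≃ₐ[F] E) (N : ℕ)
  (J : Matrix (Fin N) (Fin N) E)

omit [NumberField F] in
/-- `(c ⊗ 1)(J ⊗ 1) = (cJ) ⊗ 1` over `𝔸_E`. [cite: PlatonovRapinchuk1994, §5.1] -/
theorem adelicForm_map_conjAdele : (adelicForm E N J).map (conjAdele F E c) = adelicForm E N (J.map (c : E →+* E)) := by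
  rw [adelicForm, adelicForm, Matrix.map_map, Matrix.map_map]
  exact congrArg J.map (funext fun x => (algebraMap_conj F E c x).symm)

omit [NumberField F] in
/-- `(c ⊗ 1)(J ⊗ 1) = (cJ) ⊗ 1` over `𝔸_E^∞`. [cite: PlatonovRapinchuk1994, §5.1] -/
theorem finiteAdelicForm_map_conjFiniteAdele :
    (finiteAdelicForm E N J).map (conjFiniteAdele F E c) = finiteAdelicForm E N (J.map (c : E →+* E)) := by
  rw [finiteAdelicForm, finiteAdelicForm, Matrix.map_map, Matrix.map_map]
  refine congrArg J.map (funext fun x => ?_)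
  show c • algebraMap E (FiniteAdeleRing (𝓞 E) E) x = algebraMap E (FiniteAdeleRing (𝓞 E) E) (c x)
  rw [FiniteAdeleRing.smul_algebraMap]
  rfl

omit [NumberField F] [NumberField E] in
/-- `(c ⊗ 1)(J ⊗ 1) = (cJ) ⊗ 1` over `E ⊗ ℝ`. [cite: PlatonovRapinchuk1994, §5.1] -/
theorem archFormOf_map_conjMixed : (archFormOf E N J).map (conjMixed F E c) = archFormOf E N (J.map (c : E →+* E)) := by
  rw [archFormOf, archFormOf, Matrix.map_map, Matrix.map_map]
  exact congrArg J.map (funext fun x => conjMixed_mixedEmbedding F E c x)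

/-- **`g ↦ ḡ = (c ⊗ 1) g : U(J)(𝔸_F) →* U(cJ)(𝔸_F)`.** [cite: PlatonovRapinchuk1994, §2.3, §5.1] -/
def adelicConjTo : (adelicGroupData F E c N J).Adelic →* (adelicGroupData F E c N (J.map (c : E →+* E))).Adelic :=
  (MulEquiv.subgroupCongr (congrArg (unitaryGroupOfForm (conjAdele F E c)) (adelicForm_map_conjAdele F E c N J))).toMonoidHom.comp
    (unitaryGroupOfFormMap (conjAdele F E c) (τ := conjAdele F E c) (fun _ => rfl) (adelicForm E N J))

/-- underlying matrix of `adelicConjTo g`: `GL(c ⊗ 1) g`. [cite: PlatonovRapinchuk1994, §5.1] -/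
@[simp] theorem adelicVal_adelicConjTo (g : (adelicGroupData F E c N J).Adelic) :
    adelicVal F E c N (J.map (c : E →+* E)) (adelicConjTo F E c N J g) = Matrix.GeneralLinearGroup.map (conjAdele F E c) (adelicVal F E c N J g) := rfl

/-- **`g ↦ ḡ : U(J)(𝔸_{F,f}) →* U(cJ)(𝔸_{F,f})`.** [cite: PlatonovRapinchuk1994, §5.1] -/
def finAdelicConjTo : finAdelic F E c N J →* finAdelic F E c N (J.map (c : E →+* E)) :=
  (MulEquiv.subgroupCongr (congrArg (unitaryGroupOfForm (conjFiniteAdele F E c)) (finiteAdelicForm_map_conjFiniteAdele F E c N J))).toMonoidHom.comp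
    (unitaryGroupOfFormMap (conjFiniteAdele F E c) (τ := conjFiniteAdele F E c) (fun _ => rfl) (finiteAdelicForm E N J))

omit [NumberField F] in
/-- underlying matrix of `finAdelicConjTo g`: `GL(c ⊗ 1) g`. [cite: PlatonovRapinchuk1994, §5.1] -/
@[simp] theorem coe_finAdelicConjTo (g : finAdelic F E c N J) :
    ((finAdelicConjTo F E c N J g : finAdelic F E c N (J.map (c : E →+* E))) : GL (Fin N) (FiniteAdeleRing (𝓞 E) E)) =
      Matrix.GeneralLinearGroup.map (conjFiniteAdele F E c) (g : GL (Fin N) (FiniteAdeleRing (𝓞 E) E)) := rfl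

omit [NumberField F] in
/-- `finAdelicConjTo` is continuous. [cite: PlatonovRapinchuk1994, §5.1] -/
theorem continuous_finAdelicConjTo : Continuous (finAdelicConjTo F E c N J) := by
  refine Continuous.subtype_mk ?_ _
  exact ((continuous_conjFiniteAdele F E c).generalLinearGroup_map).comp continuous_subtype_val

/-- **`γ ↦ c(γ) : U(J)(F) →* U(cJ)(F)`.** [cite: PlatonovRapinchuk1994, §2.3] -/
def rationalConjTo : rational F E c N J →* rational F E c N (J.map (c : E →+* E)) :=
  unitaryGroupOfFormMap (σ := (c : E →+* E)) (τ := (c : E →+* E)) (c : E →+* E) (fun _ : E => rfl) J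

/-- **`g_∞ ↦ \overline{g_∞} : U(J)(E ⊗ ℝ) →* U(cJ)(E ⊗ ℝ)`.** [cite: PlatonovRapinchuk1994, §5.1] -/
def archConjTo : arch F E c N J →* arch F E c N (J.map (c : E →+* E)) :=
  (MulEquiv.subgroupCongr (congrArg (unitaryGroupOfForm (conjMixed F E c)) (archFormOf_map_conjMixed F E c N J))).toMonoidHom.comp
    (unitaryGroupOfFormMap (conjMixed F E c) (τ := conjMixed F E c) (fun _ => rfl) (archFormOf E N J))

omit [NumberField F] [NumberField E] in
/-- underlying matrix of `archConjTo g`: `GL(c ⊗ 1) g`. [cite: PlatonovRapinchuk1994, §5.1] -/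
@[simp] theorem coe_archConjTo (g : arch F E c N J) :
    ((archConjTo F E c N J g : arch F E c N (J.map (c : E →+* E))) : GL (Fin N) (mixedSpace E)) =
      Matrix.GeneralLinearGroup.map (conjMixed F E c) (g : GL (Fin N) (mixedSpace E)) := rfl

omit [NumberField F] in
/-- `(c ⊗ 1) ∘ (c ⊗ 1) = 1` on `GL_N(𝔸_E)` when `c` is an involution. [cite: PlatonovRapinchuk1994, §5.1] -/
theorem map_conjAdele_map_conjAdele (hcc : ∀ x : E, c (c x) = x) (g : GL (Fin N) (AdeleRing (𝓞 E) E)) :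
    Matrix.GeneralLinearGroup.map (conjAdele F E c) (Matrix.GeneralLinearGroup.map (conjAdele F E c) g) = g := by
  have hc1 : c * c = 1 := AlgEquiv.ext fun x => by rw [AlgEquiv.mul_apply, hcc, AlgEquiv.one_apply]
  refine Units.ext (Matrix.ext fun i j => ?_)
  change conjAdele F E c (conjAdele F E c ((g : Matrix (Fin N) (Fin N) (AdeleRing (𝓞 E) E)) i j)) = _
  rw [conjAdele_apply, conjAdele_apply, smul_smul, hc1, one_smul]

/-- **`adelicConjTo` is onto** when `c` is an involution (its inverse is `(c ⊗ 1)` again, `U(c(cJ)) = U(J)`). [cite: PlatonovRapinchuk1994, §2.3, §5.1] -/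
theorem adelicConjTo_surjective (hcc : ∀ x : E, c (c x) = x) : Function.Surjective (adelicConjTo F E c N J) := by
  intro y
  have hJ : (J.map (c : E →+* E)).map (c : E →+* E) = J := by
    rw [Matrix.map_map]; conv_rhs => rw [← Matrix.map_id J]
    exact congrArg J.map (funext fun x => hcc x)
  have hy : Matrix.GeneralLinearGroup.map (conjAdele F E c) (adelicVal F E c N (J.map (c : E →+* E)) y) ∈ adelic F E c N J := by
    have h := map_mem_unitaryGroupOfForm (conjAdele F E c) (τ := conjAdele F E c) (fun _ => rfl)
      (show adelicVal F E c N (J.map (c : E →+* E)) y ∈ adelic F E c N (J.map (c : E →+* E)) from y.2)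
    rw [adelicForm_map_conjAdele, hJ] at h
    exact h
  refine ⟨⟨_, hy⟩, adelicVal_injective F E c N _ ?_⟩
  rw [adelicVal_adelicConjTo]
  exact map_conjAdele_map_conjAdele F E c N hcc _

/-! ## §2 Compatibility with the factors `𝔸 = (E ⊗ ℝ) × 𝔸_f` and with the rational points -/

omit [NumberField F] in
/-- `(c ⊗ 1)(1, g) = (1, (c ⊗ 1) g)` in `GL_N(𝔸_E)`. [cite: PlatonovRapinchuk1994, §5.1] -/
private theorem glMap_conjAdele_ofFinite (g : GL (Fin N) (FiniteAdeleRing (𝓞 E) E)) :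
    Matrix.GeneralLinearGroup.map (conjAdele F E c) (GLn.ofFinite N E g) =
      GLn.ofFinite N E (Matrix.GeneralLinearGroup.map (conjFiniteAdele F E c) g) := by
  refine Units.ext (Matrix.ext fun i j => ?_)
  change conjAdele F E c ((GLn.ofFinite N E g : Matrix (Fin N) (Fin N) (AdeleRing (𝓞 E) E)) i j) =
    (GLn.ofFinite N E (Matrix.GeneralLinearGroup.map (conjFiniteAdele F E c) g) : Matrix (Fin N) (Fin N) (AdeleRing (𝓞 E) E)) i j
  rw [GLn.coe_ofFinite_apply, GLn.coe_ofFinite_apply, conjAdele_apply]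
  refine Prod.ext ?_ rfl
  rw [AdeleRing.smul_fst, Matrix.one_apply]
  split_ifs
  · exact smul_one c
  · exact smul_zero c

omit [NumberField F] in
/-- `(c ⊗ 1)(g_∞, 1) = ((c ⊗ 1) g_∞, 1)` in `GL_N(𝔸_E)`. [cite: PlatonovRapinchuk1994, §5.1] -/
private theorem glMap_conjAdele_ofInfinite (g : GL (Fin N) (mixedSpace E)) :
    Matrix.GeneralLinearGroup.map (conjAdele F E c) (GLn.ofInfinite N E g) =
      GLn.ofInfinite N E (Matrix.GeneralLinearGroup.map (conjMixed F E c) g) := by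
  refine Units.ext (Matrix.ext fun i j => ?_)
  change conjAdele F E c ((GLn.ofInfinite N E g : Matrix (Fin N) (Fin N) (AdeleRing (𝓞 E) E)) i j) =
    (GLn.ofInfinite N E (Matrix.GeneralLinearGroup.map (conjMixed F E c) g) : Matrix (Fin N) (Fin N) (AdeleRing (𝓞 E) E)) i j
  rw [GLn.coe_ofInfinite_apply, GLn.coe_ofInfinite_apply, conjAdele_apply]
  refine Prod.ext ?_ ?_
  · rw [AdeleRing.smul_fst]
    exact (ringEquiv_symm_conjMixed F E c _).symm
  · rw [AdeleRing.smul_snd, Matrix.one_apply]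
    split_ifs
    · exact smul_one c
    · exact smul_zero c

/-- **`\overline{(1, g)} = (1, \overline{g})`.** [cite: PlatonovRapinchuk1994, §5.1] -/
theorem adelicConjTo_finAdelicToAdelic (g : finAdelic F E c N J) :
    adelicConjTo F E c N J (finAdelicToAdelic F E c N J g) = finAdelicToAdelic F E c N (J.map (c : E →+* E)) (finAdelicConjTo F E c N J g) :=
  adelicVal_injective F E c N _ (glMap_conjAdele_ofFinite F E c N _)

/-- **`\overline{(g_∞, 1)} = (\overline{g_∞}, 1)`.** [cite: PlatonovRapinchuk1994, §5.1] [cite: BorelJacquet1979, §4.1] -/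
theorem adelicConjTo_archToAdelic (g : arch F E c N J) :
    adelicConjTo F E c N J (archToAdelic F E c N J g) = archToAdelic F E c N (J.map (c : E →+* E)) (archConjTo F E c N J g) :=
  adelicVal_injective F E c N _ (glMap_conjAdele_ofInfinite F E c N _)

/-- **rational points go to rational points: `\overline{γ ⊗ 1} = c(γ) ⊗ 1`.** [cite: PlatonovRapinchuk1994, §5.1] -/
theorem adelicConjTo_toAdelic (γ : rational F E c N J) :
    adelicConjTo F E c N J ((adelicGroupData F E c N J).toAdelic γ) =
      (adelicGroupData F E c N (J.map (c : E →+* E))).toAdelic (rationalConjTo F E c N J γ) := by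
  refine adelicVal_injective F E c N _ (Units.ext (Matrix.ext fun i j => ?_))
  change conjAdele F E c (algebraMap E (AdeleRing (𝓞 E) E) (((γ : GL (Fin N) E) : Matrix (Fin N) (Fin N) E) i j)) =
    algebraMap E (AdeleRing (𝓞 E) E) ((c : E →+* E) (((γ : GL (Fin N) E) : Matrix (Fin N) (Fin N) E) i j))
  rw [algebraMap_conj]

/-- the range of the rational points is carried into the range of the rational points. [cite: PlatonovRapinchuk1994, §5.1] -/
theorem adelicConjTo_mem_range_toAdelic {x : (adelicGroupData F E c N J).Adelic} (hx : x ∈ (adelicGroupData F E c N J).toAdelic.range) :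
    adelicConjTo F E c N J x ∈ (adelicGroupData F E c N (J.map (c : E →+* E))).toAdelic.range := by
  obtain ⟨γ, rfl⟩ := hx
  exact ⟨rationalConjTo F E c N J γ, (adelicConjTo_toAdelic F E c N J γ).symm⟩

variable (hc : c ≠ 1) (hfix : ∀ w : InfinitePlace E, c • w = w)

omit [NumberField F] [NumberField E] in
/-- **place by place `(\overline{g_∞})_w = \overline{(g_∞)_w}`** (at a complex place fixed by `c`, `c ⊗ 1` is complex conjugation on the `w`-coordinate).
[cite: BorelJacquet1979, §4.1] -/
theorem coe_archAt_archConjTo (w : {w : InfinitePlace E // IsComplex w}) (g : arch F E c N J) :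
    ((archAt F E c N (J.map (c : E →+* E)) w (hfix w.1) hc (archConjTo F E c N J g) : archLocal E N (J.map (c : E →+* E)) w) : GL (Fin N) ℂ) =
      Matrix.GeneralLinearGroup.map (starRingEnd ℂ) ((archAt F E c N J w (hfix w.1) hc g : archLocal E N J w) : GL (Fin N) ℂ) := by
  refine Units.ext (Matrix.ext fun i j => ?_)
  change evalC E w (conjMixed F E c (((g : GL (Fin N) (mixedSpace E)) : Matrix (Fin N) (Fin N) (mixedSpace E)) i j)) =
    starRingEnd ℂ (evalC E w (((g : GL (Fin N) (mixedSpace E)) : Matrix (Fin N) (Fin N) (mixedSpace E)) i j))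
  exact evalC_conjMixed F E c (hfix w.1) hc _

omit [NumberField F] [NumberField E] in
/-- `archConjTo` maps `ker archAt_w` into `ker archAt_w`. [cite: BorelJacquet1979, §4.1] -/
theorem archConjTo_mem_ker_archAt {w : {w : InfinitePlace E // IsComplex w}} {g : arch F E c N J}
    (hg : g ∈ (archAt F E c N J w (hfix w.1) hc).ker) : archConjTo F E c N J g ∈ (archAt F E c N (J.map (c : E →+* E)) w (hfix w.1) hc).ker := by
  rw [MonoidHom.mem_ker] at hg ⊢
  apply Subtype.ext
  rw [coe_archAt_archConjTo, hg, OneMemClass.coe_one, map_one, OneMemClass.coe_one]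

/-- **`\overline{adelicSingle_w x} = adelicSingle_w x̄`**: the archimedean element concentrated at `w` with coordinate `x` goes to the one with coordinate
`x̄` (all other coordinates `1̄ = 1`). [cite: BorelJacquet1979, §4.1] -/
theorem adelicConjTo_adelicSingle (w : {w : InfinitePlace E // IsComplex w}) (x : archLocal E N J w) (x' : archLocal E N (J.map (c : E →+* E)) w)
    (hx : (x' : GL (Fin N) ℂ) = Matrix.GeneralLinearGroup.map (starRingEnd ℂ) (x : GL (Fin N) ℂ)) :
    adelicConjTo F E c N J (adelicSingle F E c N J hc hfix w x) = adelicSingle F E c N (J.map (c : E →+* E)) hc hfix w x' := by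
  classical
  rw [adelicSingle_apply, adelicSingle_apply, adelicConjTo_archToAdelic]
  congr 1
  -- compare all archimedean coordinates
  apply (archPiEquiv F E c N (J.map (c : E →+* E)) hc hfix).injective
  funext w'
  rw [archPiEquiv_apply, archPiEquiv_apply, archSingle_apply F E c N (J.map (c : E →+* E)), archAt_archPiEquiv_symm]
  apply Subtype.ext
  rw [coe_archAt_archConjTo, archSingle_apply, archAt_archPiEquiv_symm]
  by_cases h : w' = w
  · subst h
    rw [Pi.mulSingle_eq_same, Pi.mulSingle_eq_same, hx]
  · rw [Pi.mulSingle_eq_of_ne h, Pi.mulSingle_eq_of_ne h, OneMemClass.coe_one, OneMemClass.coe_one, map_one]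

end Generic

/-! ## §3 CM frames: the section through `(ι, T)` of `U(H)` and the section through `(ι, T̄)` of `U(c̄H)` -/

section CM

open Literature.NumberTheory.Automorphic.UnitaryGroup.CotangentForms

variable (L : Type) [Field L] [NumberField L] [IsCMField L] (ι : L →+* ℂ) (H : Matrix (Fin 3) (Fin 3) L) (T : GL (Fin 3) ℂ)
  (hT : (T : Matrix (Fin 3) (Fin 3) ℂ)ᴴ * H.map ι * (T : Matrix (Fin 3) (Fin 3) ℂ) = BallModel.J)

/-- `(c̄H)^ι = \overline{H^ι}` (`ι ∘ c̄ = conj ∘ ι` on a CM field). [cite: PlatonovRapinchuk1994, §2.3] -/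
theorem map_complexConj_map : (H.map (IsCMField.complexConj L : L →+* L)).map ι = (H.map ι).map (starRingEnd ℂ) := by
  rw [Matrix.map_map, Matrix.map_map]
  refine congrArg H.map (funext fun x => ?_)
  simp only [Function.comp_apply, RingHom.coe_coe]
  exact IsCMField.complexEmbedding_complexConj (K := L) ι x

/-- `J̄ = J`. [folklore] -/
private theorem J_map_conj'' : BallModel.J.map (starRingEnd ℂ) = BallModel.J := by
  rw [BallModel.J, Matrix.diagonal_map (map_zero _)]
  congr 1
  funext i
  fin_cases i <;> simp

include hT in
/-- **`T̄ = GL₃(conj) T` is a frame of the conjugate hermitian matrix `c̄H` at the SAME embedding `ι`**: `T̄ᴴ (c̄H)^ι T̄ = \overline{Tᴴ H^ι T} = J`.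
[cite: PlatonovRapinchuk1994, §2.3] -/
theorem conjTranspose_conjFrame_map_complexConj_mul :
    ((Matrix.GeneralLinearGroup.map (starRingEnd ℂ) T : GL (Fin 3) ℂ) : Matrix (Fin 3) (Fin 3) ℂ)ᴴ * (H.map (IsCMField.complexConj L : L →+* L)).map ι *
        ((Matrix.GeneralLinearGroup.map (starRingEnd ℂ) T : GL (Fin 3) ℂ) : Matrix (Fin 3) (Fin 3) ℂ) = BallModel.J := by
  rw [map_complexConj_map L ι H]
  have hc : ((Matrix.GeneralLinearGroup.map (starRingEnd ℂ) T : GL (Fin 3) ℂ) : Matrix (Fin 3) (Fin 3) ℂ) = (T : Matrix (Fin 3) (Fin 3) ℂ).map (starRingEnd ℂ) := rfl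
  have h := congrArg (fun M : Matrix (Fin 3) (Fin 3) ℂ => M.map (starRingEnd ℂ)) hT
  simp only [Matrix.map_mul, J_map_conj''] at h
  rw [hc, ← Matrix.conjTranspose_map (starRingEnd ℂ) (fun z => by simp)]
  exact h

/-- **the conjugation carries the section through `(ι, T)` of `U(H)` to the section through `(ι, T̄)` of `U(c̄H)` up to `u ↦ ū`**:
`\overline{ι_{H,ι,T}(u)} = ι_{c̄H,ι,T̄}(ū)` — both are concentrated at the place of `ι`, with `σ_w`-coordinates `embTwist_ι (T u T⁻¹)` resp.
`embTwist_ι (T̄ ū T̄⁻¹)`, and `embTwist_ι` commutes with conjugation. [cite: BorelJacquet1979, §4.1] [cite: PlatonovRapinchuk1994, §2.3] -/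
theorem adelicConjTo_cmArchSection
    (hT' : ((Matrix.GeneralLinearGroup.map (starRingEnd ℂ) T : GL (Fin 3) ℂ) : Matrix (Fin 3) (Fin 3) ℂ)ᴴ * (H.map (IsCMField.complexConj L : L →+* L)).map ι *
        ((Matrix.GeneralLinearGroup.map (starRingEnd ℂ) T : GL (Fin 3) ℂ) : Matrix (Fin 3) (Fin 3) ℂ) = BallModel.J) (u : U21) :
    adelicConjTo (↥(maximalRealSubfield L)) L (IsCMField.complexConj L) 3 H (cmArchSection L ι H T hT u) =
      cmArchSection L ι (H.map (IsCMField.complexConj L : L →+* L)) (Matrix.GeneralLinearGroup.map (starRingEnd ℂ) T) hT' (conjU21 u) := by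
  rw [cmArchSection_eq, cmArchSection_eq]
  unfold archSectionU21CM
  rw [archSectionU21Emb_apply, archSectionU21Emb_apply]
  refine adelicConjTo_adelicSingle (↥(maximalRealSubfield L)) L (IsCMField.complexConj L) 3 H _ _ _ _ _ ?_
  rw [coe_archLocalOfEmb, coe_archLocalOfEmb, coe_formEquivU21_symm_apply, coe_formEquivU21_symm_apply]
  have hu : ((conjU21 u : U21) : GL (Fin 3) ℂ) = Matrix.GeneralLinearGroup.map (starRingEnd ℂ) (u : GL (Fin 3) ℂ) := rfl
  rw [hu, ← map_inv, ← map_mul, ← map_mul]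
  refine Units.ext (Matrix.ext fun i j => ?_)
  exact embTwist_conj L ι _

/-- **the conjugation carries the compact factor of `(H; ι, T)` into the compact factor of `(c̄H; ι, T̄)`** (both are `archToAdelic (ker archAt_{v(ι)})`, and
`(\overline{g_∞})_w = \overline{(g_∞)_w}`). [cite: BorelJacquet1979, §4.1] -/
theorem adelicConjTo_mem_cmCompactFactor
    (hT' : ((Matrix.GeneralLinearGroup.map (starRingEnd ℂ) T : GL (Fin 3) ℂ) : Matrix (Fin 3) (Fin 3) ℂ)ᴴ * (H.map (IsCMField.complexConj L : L →+* L)).map ι *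
        ((Matrix.GeneralLinearGroup.map (starRingEnd ℂ) T : GL (Fin 3) ℂ) : Matrix (Fin 3) (Fin 3) ℂ) = BallModel.J)
    {k : (adelicGroupData (↥(maximalRealSubfield L)) L (IsCMField.complexConj L) 3 H).Adelic} (hk : k ∈ cmCompactFactor L ι H T hT) :
    adelicConjTo (↥(maximalRealSubfield L)) L (IsCMField.complexConj L) 3 H k ∈
      cmCompactFactor L ι (H.map (IsCMField.complexConj L : L →+* L)) (Matrix.GeneralLinearGroup.map (starRingEnd ℂ) T) hT' := by
  rw [cmCompactFactor_eq] at hk ⊢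
  unfold archProjU21EmbCM at hk ⊢
  rw [ker_archProjU21Emb] at hk ⊢
  obtain ⟨g, hg, rfl⟩ := hk
  exact ⟨archConjTo (↥(maximalRealSubfield L)) L (IsCMField.complexConj L) 3 H g,
    archConjTo_mem_ker_archAt (↥(maximalRealSubfield L)) L (IsCMField.complexConj L) 3 H (IsCMField.complexConj_ne_one L)
      (complexConj_smul_infinitePlace L) hg,
    (adelicConjTo_archToAdelic (↥(maximalRealSubfield L)) L (IsCMField.complexConj L) 3 H g).symm⟩

end CM

end Literature.NumberTheory.Automorphic.UnitaryGroup

end
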